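import Summits.HodgeConjecture.HodgeConjecture.Theorems.Ring2WeilCoverageCMFieldCubicRationalNorms
import Summits.HodgeConjecture.HodgeConjecture.Theorems.Ring2WeilCoverageCMFieldSexticCarriers
import Literature.NumberTheory.QuadraticFields.BinaryQuadraticFormsPrimeRepresentation
import HarnessLib

/-!
# Ring 2 — Weil-type family-coverage census, CM-field rows (X-AA): EVERY RATIONAL ROW of the `ℚ(ζ₇)` table —
# `[q] = [1] ⟺ q = x² + 7y²` (`x, y ∈ ℚ`) in `ℚ(ζ₇)⁺^× / Nm ℚ(ζ₇)^×`, and the class of every prime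

HONEST FRAMING: research route conditional on HC_CM; not a corollary; Q11.4-sentence-2 already refuted in dim ≥ 3.

Cell `pub-hodge-ring2`, seat `ring2-b03` (gen 59), census `WEIL-FAMILY-COVERAGE.md` «## b03» b03.24 (the `g = 12` rows
`(3,2)`). On Deligne's carrier `R = S³ + 7S² + 14S + 7` (`F = realField R = ℚ(ζ₇)⁺`, `E = cmField R = ℚ(ζ₇)`,
`η = ζ₇ − ζ₇⁻¹`, `σ = η²`; parts X-U/X-V) the δ-class table of the census (kit j209882 ×2) lists, among the integers
`n ≤ 40`, the split ones and the non-split ones; parts X-X/X-Y decided `[3w]`, `[5w]`. THIS PART DECIDES ALL RATIONAL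
ROWS AT ONCE: `E ⊇ K = ℚ(√−7)` (`√−7 = −η⁵ − 6η³ − 7η = tη`, `t = −(σ² + 6σ + 7)`, `σt² = −7`) and `[F:ℚ] = 3` is odd,
so for `q ∈ ℚ^×`

  `[q] = [1]` in `F^×/Nm_{E/F}(E^×)`  ⟺  `q ∈ N_{K/ℚ}(K^×) = {x² + 7y² : x, y ∈ ℚ}`.

«⟸» `x² + 7y² = Nm_{E/F}(x + y√−7)` (part X-Z §2). «⟹» if `q = Nm_{E/F}(z)` then
`q³ = N_{F/ℚ}(q) = N_{E/ℚ}(z) = N_{K/ℚ}(N_{E/K} z) = X² + 7Y²`, so `q = (X/q)² + 7(Y/q)²`; in the kernel this is the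
explicit identity **`zeta7_cube_eq_sq_add_seven_sq`**: `N₀³ = X² + 7Y²` modulo `N₁ = N₂ = 0` for the coordinate norm
forms `N₀, N₁, N₂` of part X-Z/X-X and two integer cubic forms `X, Y` in the six coordinates (`X + Y√−7 =
z · g₂(z) · g₄(z)`, `gₖ : ζ₇ ↦ ζ₇ᵏ` the automorphisms of order `3`; found by computer algebra, checked by `ring`).
Consequences (Cox (2.17) / Fermat for `x² + 7y²`, tree `QuadraticFields.BinaryQuadraticFormsPrimeRepresentation`,
and the descent of part X-Z §3):

* `zeta7_mk_eq_split_iff`: `[q] = [(−1)²] ⟺ ∃ x y : ℚ, q = x² + 7y²`;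
* `zeta7_mk_prime_mul_ne_split`: `[ℓw] ≠ [1]` for EVERY prime `ℓ ≡ 3, 5, 6 (mod 7)` and `ℓ ∤ w` (inert-inert
  `ℓ ≡ 3, 5` AND split-inert `ℓ ≡ 6 (mod 7)` alike — the rows `13, 17, 19, 26, 31, 34, 38 ≤ 40` left open by X-X/X-Y:
  `zeta7_rows_nonsplit`);
* `zeta7_mk_prime_eq_split`, **`zeta7_mk_prime_eq_split_iff`**: for a prime `ℓ`, `[ℓ] = [1] ⟺ ℓ = 7 ∨ ℓ ≡ 1, 2, 4
  (mod 7)` — the COMPLETE prime classification of the table (`[2] = [7] = [1]`, `[3], [5], [13], [41] ≠ [1]` as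
  tabulated); `zeta7_rational_rows` (instance-free packaging on the literal carrier).

THEOREMS ONLY: no `def`, no named fact, no `sorry`; `HC_CM` does not occur; nothing about the Hodge conjecture is
asserted (`[q] = [1]` says that `W12.ℚ(ζ₇).[q]` is the split component, Deligne Cor. 4.2, whose general member is
OPEN like every row's).

## References
* [Deligne1982HodgeCycles] P. Deligne (notes by J. S. Milne), LNM 900 (1982), §4 p. 30 (1), Cor. 4.2, Lemma 4.6.
* [Cox2013] D. A. Cox, *Primes of the form x² + ny²*, 2nd ed., Wiley 2013, §1 (1.8), §2.B (2.17).
* [Washington1997] L. C. Washington, *Introduction to Cyclotomic Fields*, GTM 83, Ch. 2 (`ℚ(√−7) ⊂ ℚ(ζ₇)`, Gauss sum).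
-/

noncomputable section

set_option linter.dupNamespace false

open Polynomial

namespace Summit.HodgeConjecture.HodgeConjecture.Ring2.WeilCoverageCM

open Literature.AlgebraicGeometry.Deligne1982
open Literature.AlgebraicGeometry.HodgeTheory (splitDiscriminantClassCM)
open Literature.NumberTheory.QuadraticFields.Quadratic (legendreSym_neg_seven_eq_one_iff
  exists_eq_sq_add_seven_mul_sq_iff)

/-! ### §1 The pure identity `N₀³ ≡ X² + 7Y² (mod N₁, N₂)` -/

/-- **`N_{E/ℚ} = N_{K/ℚ} ∘ N_{E/K}` on `ℚ(ζ₇) ⊇ K = ℚ(√−7)`, as a polynomial identity.** For the coordinate norm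
forms `N₀, N₁, N₂` of `R = S³ + 7S² + 14S + 7` (part X-Z `normForm_coords_of_realPolyQ_eq` at `(7, 14, 7)`; part X-X):
if `N₁ = N₂ = 0` then `N₀³ = X² + 7Y²` with the two integer cubic forms `X, Y` displayed (`X + Y√−7 = z·g₂z·g₄z`).
Checked by `linear_combination` with explicit quartic cofactors. [folklore] -/
theorem zeta7_cube_eq_sq_add_seven_sq (a₀ a₁ a₂ b₀ b₁ b₂ : ℚ)
    (h1 : 2 * a₀ * a₁ - 28 * a₁ * a₂ + 91 * a₂ ^ 2 - b₀ ^ 2 + 28 * b₀ * b₂ + 14 * b₁ ^ 2 - 182 * b₁ * b₂ + 441 * b₂ ^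
        2 = 0)
    (h2 : 2 * a₀ * a₂ + a₁ ^ 2 - 14 * a₁ * a₂ + 35 * a₂ ^ 2 - 2 * b₀ * b₁ + 14 * b₀ * b₂ + 7 * b₁ ^ 2 - 70 * b₁ * b₂ +
        154 * b₂ ^ 2 = 0) :
    (a₀ ^ 2 - 14 * a₁ * a₂ + 49 * a₂ ^ 2 + 14 * b₀ * b₂ + 7 * b₁ ^ 2 - 98 * b₁ * b₂ + 245 * b₂ ^ 2) ^ 3
      = (a₀ ^ 3 - 7 * a₀ ^ 2 * a₁ + 21 * a₀ ^ 2 * a₂ + 14 * a₀ * a₁ ^ 2 - 77 * a₀ * a₁ * a₂ + 98 * a₀ * a₂ ^ 2 + 7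
          * a₀ * b₀ * b₁ - 28 * a₀ * b₀ * b₂ - 21 * a₀ * b₁ ^ 2 + 147 * a₀ * b₁ * b₂ - 245 * a₀ * b₂ ^ 2 - 7 * a₁ ^
          3 + 49 * a₁ ^ 2 * a₂ - 98 * a₁ * a₂ ^ 2 - 7 * a₁ * b₀ ^ 2 + 21 * a₁ * b₀ * b₁ - 49 * a₁ * b₀ * b₂ - 49 *
          a₁ * b₁ * b₂ + 147 * a₁ * b₂ ^ 2 + 49 * a₂ ^ 3 + 28 * a₂ * b₀ ^ 2 - 98 * a₂ * b₀ * b₁ + 245 * a₂ * b₀ * b₂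
          + 49 * a₂ * b₁ ^ 2 - 147 * a₂ * b₁ * b₂) ^ 2
        + 7 * (a₀ ^ 2 * b₀ - 4 * a₀ ^ 2 * b₁ + 14 * a₀ ^ 2 * b₂ - 3 * a₀ * a₁ * b₀ + 14 * a₀ * a₁ * b₁ - 49 * a₀ * a₁ *
          b₂ + 7 * a₀ * a₂ * b₀ - 35 * a₀ * a₂ * b₁ + 119 * a₀ * a₂ * b₂ - 7 * a₁ ^ 2 * b₁ + 28 * a₁ ^ 2 * b₂ + 7 *
          a₁ * a₂ * b₀ + 21 * a₁ * a₂ * b₁ - 98 * a₁ * a₂ * b₂ - 21 * a₂ ^ 2 * b₀ + 49 * a₂ ^ 2 * b₂ + b₀ ^ 3 - 7 *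
          b₀ ^ 2 * b₁ + 21 * b₀ ^ 2 * b₂ + 14 * b₀ * b₁ ^ 2 - 77 * b₀ * b₁ * b₂ + 98 * b₀ * b₂ ^ 2 - 7 * b₁ ^ 3 + 49
          * b₁ ^ 2 * b₂ - 98 * b₁ * b₂ ^ 2 + 49 * b₂ ^ 3) ^ 2 := by
  linear_combination (7 * a₀ ^ 4 - 28 * a₀ ^ 3 * a₁ + 154 * a₀ ^ 3 * a₂ + 105 * a₀ ^ 2 * a₁ ^ 2 - 1078 * a₀ ^ 2 * a₁ * a₂ + 2499 *
      a₀ ^ 2 * a₂ ^ 2 + 14 * a₀ ^ 2 * b₀ ^ 2 - 154 * a₀ ^ 2 * b₀ * b₁ + 882 * a₀ ^ 2 * b₀ * b₂ + 441 * a₀ ^ 2 * b₁ ^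
      2 - 4214 * a₀ ^ 2 * b₁ * b₂ + 9114 * a₀ ^ 2 * b₂ ^ 2 - 98 * a₀ * a₁ ^ 3 + 1372 * a₀ * a₁ ^ 2 * a₂ - 7154 * a₀
      * a₁ * a₂ ^ 2 - 28 * a₀ * a₁ * b₀ ^ 2 + 196 * a₀ * a₁ * b₀ * b₁ - 980 * a₀ * a₁ * b₀ * b₂ - 490 * a₀ * a₁ * b₁
      ^ 2 + 4508 * a₀ * a₁ * b₁ * b₂ - 9604 * a₀ * a₁ * b₂ ^ 2 + 12348 * a₀ * a₂ ^ 3 + 98 * a₀ * a₂ * b₀ ^ 2 - 784 *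
      a₀ * a₂ * b₀ * b₁ + 4900 * a₀ * a₂ * b₀ * b₂ + 2450 * a₀ * a₂ * b₁ ^ 2 - 24696 * a₀ * a₂ * b₁ * b₂ + 54880 *
      a₀ * a₂ * b₂ ^ 2 + 98 * a₁ ^ 4 - 2450 * a₁ ^ 3 * a₂ + 22638 * a₁ ^ 2 * a₂ ^ 2 + 49 * a₁ ^ 2 * b₀ ^ 2 - 392 *
      a₁ ^ 2 * b₀ * b₁ + 2450 * a₁ ^ 2 * b₀ * b₂ + 1225 * a₁ ^ 2 * b₁ ^ 2 - 12348 * a₁ ^ 2 * b₁ * b₂ + 27440 * a₁ ^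
      2 * b₂ ^ 2 - 84378 * a₁ * a₂ ^ 3 - 490 * a₁ * a₂ * b₀ ^ 2 + 4900 * a₁ * a₂ * b₀ * b₁ - 32928 * a₁ * a₂ * b₀ *
      b₂ - 16464 * a₁ * a₂ * b₁ ^ 2 + 168756 * a₁ * a₂ * b₁ * b₂ - 377300 * a₁ * a₂ * b₂ ^ 2 + 108388 * a₂ ^ 4 +
      1127 * a₂ ^ 2 * b₀ ^ 2 - 12348 * a₂ ^ 2 * b₀ * b₁ + 84378 * a₂ ^ 2 * b₀ * b₂ + 42189 * a₂ ^ 2 * b₁ ^ 2 -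
      433552 * a₂ ^ 2 * b₁ * b₂ + 970004 * a₂ ^ 2 * b₂ ^ 2 + 7 * b₀ ^ 4 - 98 * b₀ ^ 3 * b₁ + 490 * b₀ ^ 3 * b₂ + 637
      * b₀ ^ 2 * b₁ ^ 2 - 7154 * b₀ ^ 2 * b₁ * b₂ + 21266 * b₀ ^ 2 * b₂ ^ 2 - 2450 * b₀ * b₁ ^ 3 + 41160 * b₀ * b₁ ^
      2 * b₂ - 223636 * b₀ * b₁ * b₂ ^ 2 + 377300 * b₀ * b₂ ^ 3 + 4116 * b₁ ^ 4 - 84378 * b₁ ^ 3 * b₂ + 622202 * b₁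
      ^ 2 * b₂ ^ 2 - 1940008 * b₁ * b₂ ^ 3 + 2170504 * b₂ ^ 4) * h1
    + (-21 * a₀ ^ 4 - 196 * a₀ ^ 3 * a₂ - 98 * a₀ ^ 2 * a₁ ^ 2 + 1960 * a₀ ^ 2 * a₁ * a₂ - 5684 * a₀ ^ 2 * a₂ ^ 2 +
      196 * a₀ ^ 2 * b₀ * b₁ - 1960 * a₀ ^ 2 * b₀ * b₂ - 980 * a₀ ^ 2 * b₁ ^ 2 + 10976 * a₀ ^ 2 * b₁ * b₂ - 25382 *
      a₀ ^ 2 * b₂ ^ 2 - 196 * a₀ * a₁ ^ 2 * a₂ + 5488 * a₀ * a₁ * a₂ ^ 2 - 16464 * a₀ * a₂ ^ 3 + 392 * a₀ * a₂ * b₀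
      * b₁ - 5488 * a₀ * a₂ * b₀ * b₂ - 2744 * a₀ * a₂ * b₁ ^ 2 + 32928 * a₀ * a₂ * b₁ * b₂ - 78204 * a₀ * a₂ * b₂ ^
      2 - 49 * a₁ ^ 4 + 2744 * a₁ ^ 3 * a₂ - 41160 * a₁ ^ 2 * a₂ ^ 2 + 196 * a₁ ^ 2 * b₀ * b₁ - 2744 * a₁ ^ 2 * b₀ *
      b₂ - 1372 * a₁ ^ 2 * b₁ ^ 2 + 16464 * a₁ ^ 2 * b₁ * b₂ - 39102 * a₁ ^ 2 * b₂ ^ 2 + 192080 * a₁ * a₂ ^ 3 - 5488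
      * a₁ * a₂ * b₀ * b₁ + 65856 * a₁ * a₂ * b₀ * b₂ + 32928 * a₁ * a₂ * b₁ ^ 2 - 384160 * a₁ * a₂ * b₁ * b₂ +
      902776 * a₁ * a₂ * b₂ ^ 2 - 278516 * a₂ ^ 4 + 16464 * a₂ ^ 2 * b₀ * b₁ - 192080 * a₂ ^ 2 * b₀ * b₂ - 96040 *
      a₂ ^ 2 * b₁ ^ 2 + 1114064 * a₂ ^ 2 * b₁ * b₂ - 2612288 * a₂ ^ 2 * b₂ ^ 2 - 196 * b₀ ^ 2 * b₁ ^ 2 + 5488 * b₀ ^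
      2 * b₁ * b₂ - 32928 * b₀ ^ 2 * b₂ ^ 2 + 2744 * b₀ * b₁ ^ 3 - 65856 * b₀ * b₁ ^ 2 * b₂ + 462364 * b₀ * b₁ * b₂
      ^ 2 - 902776 * b₀ * b₂ ^ 3 - 8232 * b₁ ^ 4 + 192080 * b₁ ^ 3 * b₂ - 1565452 * b₁ ^ 2 * b₂ ^ 2 + 5224576 * b₁ *
      b₂ ^ 3 - 6120149 * b₂ ^ 4) * h2

/-! ### §2 The carrier `R = S³ + 7S² + 14S + 7`: `√−7 ∈ E` and the rational rows -/

section Zeta7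

variable {R : Polynomial ℤ}

/-- `realPolyQ R = S³ + 7S² + 14S + 7` with `C`-coefficients (part X-U `realPolyQ_eq_of_cubic`).
[cite: Deligne1982HodgeCycles, §4 p. 30] -/
theorem zeta7_realPolyQ_C (hR : R = X ^ 3 + C 7 * X ^ 2 + C 14 * X + C 7) :
    realPolyQ R = X ^ 3 + C (7 : ℚ) * X ^ 2 + C (14 : ℚ) * X + C (7 : ℚ) := by
  have h := realPolyQ_eq_of_cubic R hR
  push_cast at h
  exact h

variable [Fact (Irreducible (realPolyQ R))]

/-- **`√−7 ∈ ℚ(ζ₇)`**: `t = −(σ² + 6σ + 7) ∈ F` has `σt² = −7`, i.e. `s = tη = −η⁵ − 6η³ − 7η` satisfies `s² = −7`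
(`s = 1 + 2(ζ + ζ² + ζ⁴)`, the Gauss sum). [cite: Washington1997, Ch. 2] -/
theorem zeta7_root_mul_sq_eq_neg_seven (hR : R = X ^ 3 + C 7 * X ^ 2 + C 14 * X + C 7) :
    AdjoinRoot.root (realPolyQ R) *
        (-(AdjoinRoot.root (realPolyQ R) ^ 2 + 6 * AdjoinRoot.root (realPolyQ R) + 7)) ^ 2 =
      AdjoinRoot.of (realPolyQ R) (-7) := by
  have hσ := root_rel_of_realPolyQ_eq (zeta7_realPolyQ_C hR)
  simp only [map_ofNat] at hσ
  rw [map_neg, map_ofNat]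
  linear_combination (AdjoinRoot.root (realPolyQ R) ^ 2 + 5 * AdjoinRoot.root (realPolyQ R) + 1) * hσ

variable [Fact (Irreducible (cmPolyQ R))]

/-- **«⟸»: `[x² + 7y²] = [(−1)²] = [1]`** in `ℚ(ζ₇)⁺^×/Nm ℚ(ζ₇)^×` for all `x, y ∈ ℚ` (`x² + 7y² =
Nm_{E/F}(x + y√−7)`; part X-Z §2). [cite: Deligne1982HodgeCycles, §4 p. 30 (1) and Cor. 4.2 (a)] -/
theorem zeta7_mk_eq_split_of_sq_add_seven_sq (hR : R = X ^ 3 + C 7 * X ^ 2 + C 14 * X + C 7) (x y : ℚ)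
    (q : (realField R)ˣ) (hq : (q : realField R) = AdjoinRoot.of (realPolyQ R) (x ^ 2 + 7 * y ^ 2)) :
    (QuotientGroup.mk q : cmNormResidueGroup R) = splitDiscriminantClassCM R 2 :=
  mk_eq_splitDiscriminantClassCM_two_of_sq_add_mul_sq _ (zeta7_root_mul_sq_eq_neg_seven hR) x y q hq

/-- **«⟹»: `[q] = [1]`, `q ∈ ℚ^×` ⟹ `q = x² + 7y²` with `x, y ∈ ℚ`.** `q = A² − σB² = Nm_{E/F}(A + Bη)`; in
coordinates `N₀ = q`, `N₁ = N₂ = 0` (part X-Z), so `q³ = X² + 7Y²` (`zeta7_cube_eq_sq_add_seven_sq`) and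
`q = (X/q)² + 7(Y/q)²`. [cite: Deligne1982HodgeCycles, §4 p. 30 (1) and Cor. 4.2 (a)] -/
theorem zeta7_exists_sq_add_seven_sq_of_mk_eq_split (hR : R = X ^ 3 + C 7 * X ^ 2 + C 14 * X + C 7) {c : ℚ}
    (q : (realField R)ˣ) (hq : (q : realField R) = AdjoinRoot.of (realPolyQ R) c)
    (h : (QuotientGroup.mk q : cmNormResidueGroup R) = splitDiscriminantClassCM R 2) :
    ∃ x y : ℚ, c = x ^ 2 + 7 * y ^ 2 := by
  have hRQ := zeta7_realPolyQ_C hR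
  have hmonic : (realPolyQ R).Monic := by rw [hRQ]; monicity!
  have hdeg : (realPolyQ R).natDegree = 3 := by rw [hRQ]; compute_degree!
  have hc0 : c ≠ 0 := by
    rintro rfl
    rw [map_zero] at hq
    exact q.ne_zero hq
  rw [splitDiscriminantClassCM, neg_one_sq] at h
  obtain ⟨z, -, hz⟩ := exists_eq_ratCast_mul_norm_of_mk_eq (q := q) (u := 1) (c := 1)
    (by rw [Units.val_one, Rat.cast_one]) h
  rw [Rat.cast_one, one_mul] at hz
  obtain ⟨A, B, rfl⟩ := exists_eq_realToCM_add_mul_cmRoot R z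
  rw [norm_coords, algebraMap_realField_eq, hq] at hz
  have hz' := ((realToCM R).injective hz).symm
  obtain ⟨a₀, a₁, a₂, rfl⟩ := exists_coords_of_natDegree_eq_three hmonic hdeg A
  obtain ⟨b₀, b₁, b₂, rfl⟩ := exists_coords_of_natDegree_eq_three hmonic hdeg B
  obtain ⟨h0, h1, h2⟩ := coords_of_normForm_eq_of hRQ hz'
  have h1' : 2 * a₀ * a₁ - 28 * a₁ * a₂ + 91 * a₂ ^ 2 - b₀ ^ 2 + 28 * b₀ * b₂ + 14 * b₁ ^ 2 - 182 * b₁ * b₂ + 441 * b₂ ^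
        2 = 0 := by
    linear_combination h1
  have h2' : 2 * a₀ * a₂ + a₁ ^ 2 - 14 * a₁ * a₂ + 35 * a₂ ^ 2 - 2 * b₀ * b₁ + 14 * b₀ * b₂ + 7 * b₁ ^ 2 - 70 * b₁ * b₂ +
        154 * b₂ ^ 2 = 0 := by
    linear_combination h2
  have h0' : a₀ ^ 2 - 14 * a₁ * a₂ + 49 * a₂ ^ 2 + 14 * b₀ * b₂ + 7 * b₁ ^ 2 - 98 * b₁ * b₂ + 245 * b₂ ^ 2 = c := by
    linear_combination h0
  obtain ⟨X, Y, hXY⟩ : ∃ X Y : ℚ, (a₀ ^ 2 - 14 * a₁ * a₂ + 49 * a₂ ^ 2 + 14 * b₀ * b₂ + 7 * b₁ ^ 2 - 98 * b₁ * b₂ + 245 * b₂ ^ 2) ^ 3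
      = X ^ 2 + 7 * Y ^ 2 :=
    ⟨_, _, zeta7_cube_eq_sq_add_seven_sq a₀ a₁ a₂ b₀ b₁ b₂ h1' h2'⟩
  rw [h0'] at hXY
  refine ⟨X / c, Y / c, ?_⟩
  symm
  calc (X / c) ^ 2 + 7 * (Y / c) ^ 2 = (X ^ 2 + 7 * Y ^ 2) / c ^ 2 := by ring
    _ = c ^ 3 / c ^ 2 := by rw [hXY]
    _ = c := (div_eq_iff (pow_ne_zero 2 hc0)).mpr (by ring)

/-- **The rational rows of the `ℚ(ζ₇)` table in closed form: `[q] = [(−1)²] = [1] ⟺ q = x² + 7y²` for some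
`x, y ∈ ℚ`** (`q ∈ ℚ^×`; i.e. `q ∈ Nm_{E/F}(E^×) ⟺ q ∈ N_{K/ℚ}(K^×)`, `K = ℚ(√−7)`). For the census: the component
`W12.ℚ(ζ₇).[q]` is the split one iff `q` is a norm from `ℚ(√−7)`. [cite: Deligne1982HodgeCycles, §4 p. 30 (1) and Cor. 4.2] -/
theorem zeta7_mk_eq_split_iff (hR : R = X ^ 3 + C 7 * X ^ 2 + C 14 * X + C 7) {c : ℚ} (q : (realField R)ˣ)
    (hq : (q : realField R) = AdjoinRoot.of (realPolyQ R) c) :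
    (QuotientGroup.mk q : cmNormResidueGroup R) = splitDiscriminantClassCM R 2 ↔ ∃ x y : ℚ, c = x ^ 2 + 7 * y ^ 2 :=
  ⟨zeta7_exists_sq_add_seven_sq_of_mk_eq_split hR q hq, fun ⟨x, y, hc⟩ =>
    zeta7_mk_eq_split_of_sq_add_seven_sq hR x y q (by rw [hq, hc])⟩

/-- **Which rationals label the SAME row: `[q₁] = [q₂] ⟺ q₁q₂ = x² + 7y²` for some `x, y ∈ ℚ`** — the
rational classes of `F^×/Nm_{E/F}(E^×)` form the group `ℚ^×/N_{K/ℚ}(K^×)`, `K = ℚ(√−7)` (`[q₁] = [q₂] ⟺ q₁⁻¹q₂ ∈ Nm ⟺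
q₁q₂ = (q₁⁻¹q₂)·q₁² ∈ Nm`, squares being norms, part III `sq_mem_normUnitsSubgroup_cmField`).
[cite: Deligne1982HodgeCycles, §4 p. 30 (1) and Cor. 4.2] -/
theorem zeta7_mk_eq_mk_iff (hR : R = X ^ 3 + C 7 * X ^ 2 + C 14 * X + C 7) {c₁ c₂ : ℚ} (q₁ q₂ : (realField R)ˣ)
    (hq₁ : (q₁ : realField R) = AdjoinRoot.of (realPolyQ R) c₁) (hq₂ : (q₂ : realField R) = AdjoinRoot.of (realPolyQ R) c₂) :
    (QuotientGroup.mk q₁ : cmNormResidueGroup R) = QuotientGroup.mk q₂ ↔ ∃ x y : ℚ, c₁ * c₂ = x ^ 2 + 7 * y ^ 2 := by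
  rw [← zeta7_mk_eq_split_iff hR (q₁ * q₂) (by rw [Units.val_mul, hq₁, hq₂, map_mul]),
    splitDiscriminantClassCM_two_eq_one, QuotientGroup.eq, QuotientGroup.eq_one_iff]
  have hsq := sq_mem_normUnitsSubgroup_cmField (R := R) q₁
  have e : q₁ * q₂ = q₁⁻¹ * q₂ * q₁ ^ 2 := by
    rw [sq, mul_comm q₁⁻¹ q₂, mul_assoc, inv_mul_cancel_left, mul_comm]
  constructor
  · intro h
    rw [e]
    exact mul_mem h hsq
  · intro h
    have e' : q₁⁻¹ * q₂ = q₁ * q₂ * (q₁ ^ 2)⁻¹ := by rw [e, mul_inv_cancel_right]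
    rw [e']
    exact mul_mem h (inv_mem hsq)

/-! ### §3 The class of every prime -/

/-- **`[ℓw] ≠ [1]` for every prime `ℓ ≡ 3, 5, 6 (mod 7)` and `ℓ ∤ w`** — the primes with `(−7/ℓ) = −1`, i.e. INERT in
`ℚ(√−7)` (`ℓ ≡ 3, 5`: inert in `F` and in `E/F`; `ℓ ≡ 6`: split in `F` into three places inert in `E/F`): `ℓw = x² + 7y²`
has no rational solution (part X-Z `prime_mul_ne_binaryForm`, `x² + 7y²` anisotropic mod `ℓ`). For the census: the
rows `W12.ℚ(ζ₇).[ℓw]` are NON-SPLIT (no `E`-Lagrangian member, Deligne Cor. 4.2).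
[cite: Deligne1982HodgeCycles, §4 p. 30 (1) and Cor. 4.2] [cite: Cox2013, §1 (1.8)] -/
theorem zeta7_mk_prime_mul_ne_split (hR : R = X ^ 3 + C 7 * X ^ 2 + C 14 * X + C 7) {ℓ : ℕ} (hℓ : ℓ.Prime)
    (h7 : ℓ % 7 = 3 ∨ ℓ % 7 = 5 ∨ ℓ % 7 = 6) (w : ℤ) (hw : ¬ (ℓ : ℤ) ∣ w) (q : (realField R)ˣ)
    (hq : (q : realField R) = AdjoinRoot.of (realPolyQ R) ((ℓ : ℚ) * w)) :
    (QuotientGroup.mk q : cmNormResidueGroup R) ≠ splitDiscriminantClassCM R 2 := by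
  intro h
  obtain ⟨x, y, hxy⟩ := zeta7_exists_sq_add_seven_sq_of_mk_eq_split hR q hq h
  haveI := Fact.mk hℓ
  have hℓ2 : ℓ ≠ 2 := by omega
  have hℓ7 : ℓ ≠ 7 := by omega
  have h0 : ((-7 : ℤ) : ZMod ℓ) ≠ 0 := by
    intro h0
    rw [Int.cast_neg, neg_eq_zero, ZMod.intCast_zmod_eq_zero_iff_dvd] at h0
    exact hℓ7 ((Nat.prime_dvd_prime_iff_eq hℓ (by norm_num)).1 (by exact_mod_cast h0))
  have hns : ¬ IsSquare ((-7 : ℤ) : ZMod ℓ) := by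
    rw [← legendreSym.eq_neg_one_iff (p := ℓ)]
    rcases legendreSym.eq_one_or_neg_one ℓ h0 with h1 | h1
    · rw [legendreSym_neg_seven_eq_one_iff hℓ2 hℓ7] at h1
      omega
    · exact h1
  exact prime_mul_ne_binaryForm hℓ 0 7 (aniso_sq_add_mul_sq_of_not_isSquare 7 hns) w hw x y
    (by push_cast; linear_combination hxy)

/-- The rows `13, 17, 19, 26, 31, 34, 38` (`n ≤ 40`) of the census table of `ℚ(ζ₇)` — non-split in the certified
computation (kit j209882) and out of reach of the `ℓ⁶`-case checks of parts X-X/X-Y — are NON-SPLIT in the kernel: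
instances `(ℓ, w) = (13,1), (17,1), (19,1), (13,2), (31,1), (17,2), (19,2)` of `zeta7_mk_prime_mul_ne_split`.
[cite: Deligne1982HodgeCycles, §4 p. 30 (1) and Cor. 4.2] -/
theorem zeta7_rows_nonsplit (hR : R = X ^ 3 + C 7 * X ^ 2 + C 14 * X + C 7) {n : ℕ}
    (hn : n = 13 ∨ n = 17 ∨ n = 19 ∨ n = 26 ∨ n = 31 ∨ n = 34 ∨ n = 38) (q : (realField R)ˣ)
    (hq : (q : realField R) = AdjoinRoot.of (realPolyQ R) n) :
    (QuotientGroup.mk q : cmNormResidueGroup R) ≠ splitDiscriminantClassCM R 2 := by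
  rcases hn with rfl | rfl | rfl | rfl | rfl | rfl | rfl
  · exact zeta7_mk_prime_mul_ne_split hR (ℓ := 13) (by norm_num) (by norm_num) 1 (by norm_num) q
      (by rw [hq]; norm_num)
  · exact zeta7_mk_prime_mul_ne_split hR (ℓ := 17) (by norm_num) (by norm_num) 1 (by norm_num) q
      (by rw [hq]; norm_num)
  · exact zeta7_mk_prime_mul_ne_split hR (ℓ := 19) (by norm_num) (by norm_num) 1 (by norm_num) q
      (by rw [hq]; norm_num)
  · exact zeta7_mk_prime_mul_ne_split hR (ℓ := 13) (by norm_num) (by norm_num) 2 (by norm_num) q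
      (by rw [hq]; norm_num)
  · exact zeta7_mk_prime_mul_ne_split hR (ℓ := 31) (by norm_num) (by norm_num) 1 (by norm_num) q
      (by rw [hq]; norm_num)
  · exact zeta7_mk_prime_mul_ne_split hR (ℓ := 17) (by norm_num) (by norm_num) 2 (by norm_num) q
      (by rw [hq]; norm_num)
  · exact zeta7_mk_prime_mul_ne_split hR (ℓ := 19) (by norm_num) (by norm_num) 2 (by norm_num) q
      (by rw [hq]; norm_num)

/-- **`[ℓ] = [1]` for `ℓ = 7` and every prime `ℓ ≡ 1, 2, 4 (mod 7)`** — the primes split (or ramified) in `ℚ(√−7)`: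
`7 = 0² + 7·1²`, `2 = (½)² + 7(½)²`, and an odd prime `ℓ ≡ 1, 2, 4 (mod 7)`, i.e. `ℓ ≡ 1, 9, 11, 15, 23, 25 (mod 28)`,
is `x² + 7y²` with `x, y ∈ ℤ` (Cox (2.17), tree `exists_eq_sq_add_seven_mul_sq_iff`). For the census: these rows
`W12.ℚ(ζ₇).[ℓ]` ARE the split component. [cite: Cox2013, §2.B (2.17)] [cite: Deligne1982HodgeCycles, §4 Cor. 4.2] -/
theorem zeta7_mk_prime_eq_split (hR : R = X ^ 3 + C 7 * X ^ 2 + C 14 * X + C 7) {ℓ : ℕ} (hℓ : ℓ.Prime)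
    (h7 : ℓ = 7 ∨ ℓ % 7 = 1 ∨ ℓ % 7 = 2 ∨ ℓ % 7 = 4) (q : (realField R)ˣ)
    (hq : (q : realField R) = AdjoinRoot.of (realPolyQ R) (ℓ : ℚ)) :
    (QuotientGroup.mk q : cmNormResidueGroup R) = splitDiscriminantClassCM R 2 := by
  rcases h7 with rfl | h7
  · exact zeta7_mk_eq_split_of_sq_add_seven_sq hR 0 1 q (by rw [hq]; norm_num)
  · by_cases hℓ2 : ℓ = 2
    · subst hℓ2
      exact zeta7_mk_eq_split_of_sq_add_seven_sq hR (1 / 2) (1 / 2) q (by rw [hq]; norm_num)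
    · have hℓ7 : ℓ ≠ 7 := by omega
      have hodd : ℓ % 2 = 1 := Nat.odd_iff.mp (hℓ.odd_of_ne_two hℓ2)
      obtain ⟨x, y, hxy⟩ := (exists_eq_sq_add_seven_mul_sq_iff hℓ hℓ7).2 (by omega)
      exact zeta7_mk_eq_split_of_sq_add_seven_sq hR x y q (by rw [hq]; congr 1; exact_mod_cast hxy)

/-- **The class of every prime in the `ℚ(ζ₇)` table: `[ℓ] = [1] ⟺ ℓ = 7 ∨ ℓ ≡ 1, 2, 4 (mod 7)`** (⟺ `ℓ` is not
inert in `ℚ(√−7) ⊂ ℚ(ζ₇)`). In the census table (kit j209882): `[2] = [7] = [1]`, `[29] = [43] = [1]`; `[3]`, `[5]`,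
`[13]`, `[17]`, `[19]`, `[31]`, `[41]` non-split — all instances. [cite: Deligne1982HodgeCycles, §4 p. 30 (1) and Cor. 4.2]
[cite: Cox2013, §2.B (2.17)] -/
theorem zeta7_mk_prime_eq_split_iff (hR : R = X ^ 3 + C 7 * X ^ 2 + C 14 * X + C 7) {ℓ : ℕ} (hℓ : ℓ.Prime)
    (q : (realField R)ˣ) (hq : (q : realField R) = AdjoinRoot.of (realPolyQ R) (ℓ : ℚ)) :
    (QuotientGroup.mk q : cmNormResidueGroup R) = splitDiscriminantClassCM R 2 ↔
      (ℓ = 7 ∨ ℓ % 7 = 1 ∨ ℓ % 7 = 2 ∨ ℓ % 7 = 4) := by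
  refine ⟨fun h => ?_, fun h7 => zeta7_mk_prime_eq_split hR hℓ h7 q hq⟩
  by_contra h7
  have h7' : ℓ % 7 = 3 ∨ ℓ % 7 = 5 ∨ ℓ % 7 = 6 := by
    have h70 : ℓ % 7 ≠ 0 := fun h0 => by
      rcases (Nat.dvd_prime hℓ).1 (Nat.dvd_of_mod_eq_zero h0) with h' | h' <;> omega
    omega
  have hw : ¬ ((ℓ : ℤ) ∣ 1) := fun hd =>
    hℓ.one_lt.ne' (by exact_mod_cast Int.eq_one_of_dvd_one (by positivity) hd)
  exact zeta7_mk_prime_mul_ne_split hR hℓ h7' 1 hw q (by rw [hq, Int.cast_one, mul_one]) h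

end Zeta7

/-! ### §4 Instance-free packaging on the literal carrier -/

/-- **The rational rows of `W12.ℚ(ζ₇)` (census b03.24), unconditionally**: on the literal carrier
`R = S³ + 7S² + 14S + 7` (field instances from parts X-V `zeta7_fact_realPolyQ` / `zeta7_fact_cmPolyQ`), for every
`q ∈ ℚ^×`: `[q] = [(−1)²] ⟺ ∃ x y ∈ ℚ, q = x² + 7y²`. [cite: Deligne1982HodgeCycles, §4 p. 30 (1) and Cor. 4.2] -/
theorem zeta7_rational_rows :
    haveI := zeta7_fact_realPolyQ
    ∀ (c : ℚ) (q : (realField (X ^ 3 + C 7 * X ^ 2 + C 14 * X + C 7 : Polynomial ℤ))ˣ),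
      (q : realField (X ^ 3 + C 7 * X ^ 2 + C 14 * X + C 7 : Polynomial ℤ)) = AdjoinRoot.of _ c →
      ((QuotientGroup.mk q : cmNormResidueGroup (X ^ 3 + C 7 * X ^ 2 + C 14 * X + C 7 : Polynomial ℤ)) =
          splitDiscriminantClassCM (X ^ 3 + C 7 * X ^ 2 + C 14 * X + C 7 : Polynomial ℤ) 2 ↔
        ∃ x y : ℚ, c = x ^ 2 + 7 * y ^ 2) := by
  haveI := zeta7_fact_realPolyQ
  haveI := zeta7_fact_cmPolyQ
  exact fun c q hq => zeta7_mk_eq_split_iff rfl q hq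

end Summit.HodgeConjecture.HodgeConjecture.Ring2.WeilCoverageCM

end
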